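import Summits.QuantumFields.YangMills.Theorems.UnitScaleTiltProp8ChartDoubleBarStar
import Summits.QuantumFields.YangMills.Theorems.UnitScaleTiltHalvingP1FlatCoreFrameLinTowerSum
import Summits.QuantumFields.YangMills.Theorems.UnitScaleTiltHalvingP1FlatCoreFrameLinLocal
import HarnessLib

/-!
# The (Treal) suppliers at the torus instance: unitary tower stairs on `M₂(ℂ)`, and the size of `log κ_j` from ✓F2b

Sub-problem `YangMills` of summit `QuantumFields`; route `UnitScaleTilt`, line H = `BirthV10.stub_halvingStep` (crux stmt-QuantumFields-19200),
pillar P1♭ `core′`, brick J4 (induction), row (Treal) = the `hCreal` binder of ✓`HalvingP1FlatCoreTopStepFamily.hFP_kLevel_family_RD`.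
Helper file (`--supports stmt-QuantumFields-19200 --as helper`); it closes no item.  HONEST LABEL: YM₃ on `T³` is rung R3 of the ladder, NOT the Clay
problem, not d = 4, not a mass-gap statement.  Cell `ym3-torus`, width seat `ym-ust-20520-w1` gen 7.

## Why this file, and why only this much

The reality row itself — `C(−μ⋆) = −C(μ)⋆` for the nonlinear part of the effective-gauge tower — is ★w3-19936 g6's C⋆-generic
`…P1FlatCoreFrameLinReal.Cnl_negStar` (one field `W`, the tower as the hypothesis-function `κf` shared with F3 `…FrameLinLipschitz`), chosen by the (T4b)
consumer ★w8-19936 g2 (bus 12:27:10Z «both … ★w1's file carries the `M₂(ℂ)`-unitary suppliers that DISCHARGE ★w3's `hWu`∕`hWs`∕`hdisc`∕`htop` at the T³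
instance»; ★★OWNER ACK 54 (4) «one row, one content file»).  This file is therefore SHRUNK to exactly the suppliers named there; the parallel two-tower
`θ`-covariance theorem this seat typed (`theta_effGauge`, farm rc 0, HOME `ym-ust-20520-w1/g7/…FrameLinStar.FULL-v1.1-unfiled.w1g7.lean`) stays unfiled.

* §1 (`M₂(ℂ)`, L²-operator norm; the relation «`a′ = θ a := (a⋆)⁻¹`» spelled `↑a′ = (↑a⁻¹)⋆` as in ✓`Prop8ChartDoubleBarStar`):
  `theta_holT` (✓`holT_rel_of_walk`), `mem_unitaryGroup_of_theta_self` (`a = θ a ⇒ a` unitary), `theta_dbarIterU_self_of_mem_unitaryGroup`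
  (✓`theta_dbarIterU_of_reads` on the whole torus, `U′ = U`), ★★ `holT_dbarIterU_mem_unitaryGroup` — for a field of unitary bond variables within `s₀` of `1`,
  `30400·ℓ²·Lⁱ·s₀ ≤ 1`, EVERY transporter of `U̿^{(i)}` is unitary — and its `hWu`-shaped corollary ★★ `hWu_of_mem_unitaryGroup` (the binder of
  `…FrameLinReal.effGauge_negStar`∕`Cnl_negStar` VERBATIM at `𝔸 = M₂(ℂ)`: `∀ i < k, ∀ y idx, ↑(holT (dbarIterU i W) (emb y) (stairWord idx.2.1 (off idx.1))) ∈ unitary _`);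
  and the BLOCK-LOCAL twin `holT_stair_dbarIterU_mem_unitaryGroup_of_reads` (read territory = the `(i+1)`-block of `y`, for tower-local instances).
* §2 (generic complete normed `ℂ`-algebra, ✓F2b's letters VERBATIM): ★★ `exp_mlog_and_norm_mlog_effGauge_le` — under EXACTLY the hypotheses of
  ✓`P1FlatCoreFrameLinTowerSum.exp_mlog_and_norm_mlog_effGauge_sub_siteAvgIter_le`, at every level `j ≤ k`: `κ_j = e^{log κ_j}` and `‖log κ_j‖ ≤ a + ω`
  (`‖log κ_j − Q′_j l₀‖ ≤ 4εω·2^j∕2^k ≤ ω` with `4ε ≤ 1`, `‖Q′_j l₀‖ ≤ a` by ✓`norm_siteAvgIter_le`) — the `a″ := a + ω` that ★w3's window suppliers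
  `norm_stairRel_sub_one_le_twelfth` (`2δ + 4a″ ≤ 1∕24`) and `norm_exp_sub_one_le_twelfth` (`a″ ≤ 1∕24`) read; both windows follow from F2b's `160(a + δ + 5ω) ≤ 1∕4`
  (`a + δ + 5ω ≤ 1∕640`), recorded as `windows_of_towerSum`.
* §3 (generic, `[NormOneClass 𝔸]`): ★★ `norm_holT_stair_dbarIterU_sub_one_le` — for ONE globally `s₀`-small field with the budget at level `k`, every centre stair of every
  `U̿^{(j)}`, `j < k`, is within the `k`-UNIFORM `δ := 8ℓ·Lᵏ·s₀` of `1` (✓`norm_dbarIterU_sub_one_le_two_mul₀` on the whole torus + ✓`norm_holT_stair_sub_one_le`)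
  — ✓F2b's `hH` binder and ★w3's `hWs` (`δ ≤ 1∕12`) at the instance; and the BLOCK-LOCAL twin `norm_holT_stair_dbarIterU_sub_one_le_of_reads` (`δ = 8ℓ·Lⁱ·s₀`).

* §4 (v1.1 append, generic): ★★ `exp_mlog_and_norm_mlog_effGauge_le_local` — the §2 size row `‖log κ_j‖ ≤ a + ω` under EXACTLY the hypotheses of ★w3-19936 g6's
  TOWER-LOCAL ✓`P1FlatCoreFrameLinLocal.exp_mlog_and_norm_mlog_effGauge_sub_siteAvgIter_le_local` (site family `S`, closures `hSe`∕`hSs`), for the `_local` rows of (T4b).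

HONEST SCOPE.  Bookkeeping over landed letters (✓`Prop8ChartDoubleBarStar`, ✓F2b, ✓F2-local); no new estimate.  Nothing of `core′`, the stub, the crux, the rung or the gap
is claimed.

References: T. Bałaban, CMP **102** (1985) 277–309 [Balaban1985Variational] (p.307, «`Gᶜ`-valued fields»); CMP **98** (1985) 17–51 [Balaban1985Averaging]
((8)–(11) pp.18–19, (89) p.31, (110) p.34, Prop. 4 (134)–(135) p.38); CMP **99** (1985) 75–102 [Balaban1985RegularSpaces] (Sect. E (1.120)–(1.121) pp.95–96);
CMP **109** (1987) 249–301 [Balaban1987RG1] ((0.4)–(0.5) p.253).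
-/

set_option autoImplicit false

noncomputable section

open scoped BigOperators Matrix.Norms.L2Operator
open NormedSpace

namespace Summit.QuantumFields.YangMills.Theorems.P1FlatCoreFrameLinStar

open Literature.MathematicalPhysics.QuantumFieldTheory.Balaban1983to89
open T4Continuum BlockAveraging AveragingRT ExpMeanLog MatrixLog
open B10Eq27TorusAxialLog (holT gaugeActT gaugeActT_apply)
open B5Eq118OneStroke (iterBlockOf iterBlockOf_succ)
open Summit.QuantumFields.YangMills.Theorems.Prop8Chart
open Summit.QuantumFields.YangMills.Theorems.Prop8ChartDoubleBar (vframeU coe_vframeU dbarIterU theta_one theta_mul theta_inv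
  holT_rel_of_walk theta_dbarIterU_of_reads norm_dbarIterU_sub_one_le_two_mul₀ norm_holT_stair_sub_one_le)
open Summit.QuantumFields.YangMills.Theorems.P1FlatCoreFrameLinTowerSum (exp_mlog_and_norm_mlog_effGauge_sub_siteAvgIter_le norm_siteAvgIter_le)

variable {P : Params}

/-! ## §1 Unitary transporters of the double-bar tower on `M₂(ℂ)` -/

section Unitary

variable {j : ℕ}

/-- **`θ` ALONG TRANSPORTERS**: bondwise `θ`-related fields have `θ`-related transporters along every walk (✓`holT_rel_of_walk`).
[cite: Balaban1985Averaging, (9) p.18] -/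
theorem theta_holT {W W' : GaugeField P j (Matrix (Fin 2) (Fin 2) ℂ)ˣ}
    (hW : ∀ b : PBond P j, ((W' b : (Matrix (Fin 2) (Fin 2) ℂ)ˣ) : Matrix (Fin 2) (Fin 2) ℂ) =
      star (((W b)⁻¹ : (Matrix (Fin 2) (Fin 2) ℂ)ˣ) : Matrix (Fin 2) (Fin 2) ℂ)) (x : Site P j) (w : List (Letter P.d)) :
    ((holT W' x w : (Matrix (Fin 2) (Fin 2) ℂ)ˣ) : Matrix (Fin 2) (Fin 2) ℂ) =
      star (((holT W x w)⁻¹ : (Matrix (Fin 2) (Fin 2) ℂ)ˣ) : Matrix (Fin 2) (Fin 2) ℂ) :=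
  holT_rel_of_walk
    (fun (a a' : (Matrix (Fin 2) (Fin 2) ℂ)ˣ) => (a' : Matrix (Fin 2) (Fin 2) ℂ) = star ((a⁻¹ : (Matrix (Fin 2) (Fin 2) ℂ)ˣ) : Matrix (Fin 2) (Fin 2) ℂ))
    theta_one (fun _ _ _ _ ha hb => theta_mul ha hb) (fun _ _ ha => theta_inv ha) W W' x w fun st _ => hW st.bond

/-- **`a = θ a ⇒ a` IS UNITARY**: a unit of `M₂(ℂ)` equal to the adjoint of its inverse is a unitary matrix. [folklore] -/
theorem mem_unitaryGroup_of_theta_self {a : (Matrix (Fin 2) (Fin 2) ℂ)ˣ}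
    (h : (a : Matrix (Fin 2) (Fin 2) ℂ) = star ((a⁻¹ : (Matrix (Fin 2) (Fin 2) ℂ)ˣ) : Matrix (Fin 2) (Fin 2) ℂ)) :
    (a : Matrix (Fin 2) (Fin 2) ℂ) ∈ Matrix.unitaryGroup (Fin 2) ℂ := by
  have hstar : star (a : Matrix (Fin 2) (Fin 2) ℂ) = ((a⁻¹ : (Matrix (Fin 2) (Fin 2) ℂ)ˣ) : Matrix (Fin 2) (Fin 2) ℂ) := by
    rw [h, star_star]
  refine Unitary.mem_iff.mpr ⟨?_, ?_⟩
  · rw [hstar, ← Units.val_mul, inv_mul_cancel, Units.val_one]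
  · rw [hstar, ← Units.val_mul, mul_inv_cancel, Units.val_one]

/-- **THE TOWER OF ONE UNITARY-VALUED FIELD IS `θ`-FIXED**: if every bond variable of `U` is unitary and within `s₀` of `1`, `30400·ℓ²·Lⁱ·s₀ ≤ 1`, then
`U̿^{(i)}(e) = θ(U̿^{(i)}(e))` for every level-`i` bond `e` (✓`theta_dbarIterU_of_reads` on the whole torus with `U′ = U`).
[cite: Balaban1985Averaging, Prop. 4 (134)-(135) p.38; Balaban1987RG1, (0.5) p.253] -/
theorem theta_dbarIterU_self_of_mem_unitaryGroup {i : ℕ} (hi : i ≤ P.m + P.K) (U : GaugeField P 0 (Matrix (Fin 2) (Fin 2) ℂ)ˣ) {s₀ : ℝ} (hs₀ : 0 ≤ s₀)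
    (hbudget : 8 * 3800 * (((P.d + 2) * P.L : ℕ) : ℝ) ^ 2 * (P.L : ℝ) ^ i * s₀ ≤ 1)
    (hU : ∀ b : PBond P 0, ‖((U b : (Matrix (Fin 2) (Fin 2) ℂ)ˣ) : Matrix (Fin 2) (Fin 2) ℂ) - 1‖ ≤ s₀)
    (hun : ∀ b : PBond P 0, ((U b : (Matrix (Fin 2) (Fin 2) ℂ)ˣ) : Matrix (Fin 2) (Fin 2) ℂ) ∈ Matrix.unitaryGroup (Fin 2) ℂ) (e : PBond P i) :
    ((dbarIterU i U e : (Matrix (Fin 2) (Fin 2) ℂ)ˣ) : Matrix (Fin 2) (Fin 2) ℂ) =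
      star (((dbarIterU i U e)⁻¹ : (Matrix (Fin 2) (Fin 2) ℂ)ˣ) : Matrix (Fin 2) (Fin 2) ℂ) := by
  refine theta_dbarIterU_of_reads i hi Set.univ U U s₀ hs₀ hbudget (fun b _ _ => hU b) (fun b _ _ => ?_) e (Set.mem_univ _) (Set.mem_univ _)
  have h := Matrix.mem_unitaryGroup_iff.1 (hun b)
  rw [Matrix.coe_units_inv, Matrix.inv_eq_right_inv h, star_star]

/-- **★★ EVERY TRANSPORTER OF THE DOUBLE-BAR TOWER OF A UNITARY-VALUED FIELD IS UNITARY**: if every bond variable of `U` is unitary and within `s₀` of `1`,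
`30400·ℓ²·Lⁱ·s₀ ≤ 1`, then `U̿^{(i)}(Γ_{x,w})` is a unitary matrix for every level-`i` walk. [cite: Balaban1985Averaging, (9) p.18, Prop. 4 (134)-(135) p.38] -/
theorem holT_dbarIterU_mem_unitaryGroup {i : ℕ} (hi : i ≤ P.m + P.K) (U : GaugeField P 0 (Matrix (Fin 2) (Fin 2) ℂ)ˣ) {s₀ : ℝ} (hs₀ : 0 ≤ s₀)
    (hbudget : 8 * 3800 * (((P.d + 2) * P.L : ℕ) : ℝ) ^ 2 * (P.L : ℝ) ^ i * s₀ ≤ 1)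
    (hU : ∀ b : PBond P 0, ‖((U b : (Matrix (Fin 2) (Fin 2) ℂ)ˣ) : Matrix (Fin 2) (Fin 2) ℂ) - 1‖ ≤ s₀)
    (hun : ∀ b : PBond P 0, ((U b : (Matrix (Fin 2) (Fin 2) ℂ)ˣ) : Matrix (Fin 2) (Fin 2) ℂ) ∈ Matrix.unitaryGroup (Fin 2) ℂ)
    (x : Site P i) (w : List (Letter P.d)) :
    ((holT (dbarIterU i U) x w : (Matrix (Fin 2) (Fin 2) ℂ)ˣ) : Matrix (Fin 2) (Fin 2) ℂ) ∈ Matrix.unitaryGroup (Fin 2) ℂ :=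
  mem_unitaryGroup_of_theta_self (theta_holT (fun b => theta_dbarIterU_self_of_mem_unitaryGroup hi U hs₀ hbudget hU hun b) x w)


/-- **THE BLOCK-LOCAL FORM** (read territory = the `(i+1)`-block of `y`): if the bond variables of `U` whose `(i+1)`-fold block points are `y` are unitary and within
`s₀` of `1`, `30400·ℓ²·Lⁱ·s₀ ≤ 1`, then every centre stair of `U̿^{(i)}` in the block of `y` is unitary (✓`theta_dbarIterU_of_reads` with `S :=` the level-`i` sites of
the block; the stair walks read only block-internal bonds, ✓`blockOf_ends_of_mem_stairWalk`). [cite: Balaban1985Averaging, (110) p.34, Prop. 4 (134)-(135) p.38] -/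
theorem holT_stair_dbarIterU_mem_unitaryGroup_of_reads {i : ℕ} (hi : i + 1 ≤ P.m + P.K) (y : Site P (i + 1))
    (U : GaugeField P 0 (Matrix (Fin 2) (Fin 2) ℂ)ˣ) {s₀ : ℝ} (hs₀ : 0 ≤ s₀)
    (hbudget : 8 * 3800 * (((P.d + 2) * P.L : ℕ) : ℝ) ^ 2 * (P.L : ℝ) ^ i * s₀ ≤ 1)
    (hU : ∀ b : PBond P 0, iterBlockOf (i + 1) b.src = y → iterBlockOf (i + 1) b.tgt = y →
      ‖((U b : (Matrix (Fin 2) (Fin 2) ℂ)ˣ) : Matrix (Fin 2) (Fin 2) ℂ) - 1‖ ≤ s₀)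
    (hun : ∀ b : PBond P 0, iterBlockOf (i + 1) b.src = y → iterBlockOf (i + 1) b.tgt = y →
      ((U b : (Matrix (Fin 2) (Fin 2) ℂ)ˣ) : Matrix (Fin 2) (Fin 2) ℂ) ∈ Matrix.unitaryGroup (Fin 2) ℂ) (idx : Idx P) :
    ((holT (dbarIterU i U) (emb y) (stairWord idx.2.1 (off idx.1)) : (Matrix (Fin 2) (Fin 2) ℂ)ˣ) : Matrix (Fin 2) (Fin 2) ℂ) ∈
      Matrix.unitaryGroup (Fin 2) ℂ := by
  set S : Set (Site P i) := {z | blockOf z = y} with hS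
  have hθ : ∀ e : PBond P i, e.src ∈ S → e.tgt ∈ S →
      ((dbarIterU i U e : (Matrix (Fin 2) (Fin 2) ℂ)ˣ) : Matrix (Fin 2) (Fin 2) ℂ) =
        star (((dbarIterU i U e)⁻¹ : (Matrix (Fin 2) (Fin 2) ℂ)ˣ) : Matrix (Fin 2) (Fin 2) ℂ) := by
    refine theta_dbarIterU_of_reads i (Nat.le_of_succ_le hi) S U U s₀ hs₀ hbudget
      (fun b hs ht => hU b (by rw [iterBlockOf_succ]; exact hs) (by rw [iterBlockOf_succ]; exact ht))
      (fun b hs ht => ?_)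
    have h := Matrix.mem_unitaryGroup_iff.1 (hun b (by rw [iterBlockOf_succ]; exact hs) (by rw [iterBlockOf_succ]; exact ht))
    rw [Matrix.coe_units_inv, Matrix.inv_eq_right_inv h, star_star]
  refine mem_unitaryGroup_of_theta_self (holT_rel_of_walk
    (fun (a a' : (Matrix (Fin 2) (Fin 2) ℂ)ˣ) => (a' : Matrix (Fin 2) (Fin 2) ℂ) = star ((a⁻¹ : (Matrix (Fin 2) (Fin 2) ℂ)ˣ) : Matrix (Fin 2) (Fin 2) ℂ))
    theta_one (fun _ _ _ _ ha hb => theta_mul ha hb) (fun _ _ ha => theta_inv ha) (dbarIterU i U) (dbarIterU i U) (emb y) _ fun st hst => ?_)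
  exact hθ st.bond (blockOf_ends_of_mem_stairWalk hi y idx.1 idx.2.1 st hst).1 (blockOf_ends_of_mem_stairWalk hi y idx.1 idx.2.1 st hst).2

/-- **★★ THE `hWu` BINDER OF ✓`…FrameLinReal.effGauge_negStar`∕`Cnl_negStar` AT `𝔸 = M₂(ℂ)`**: for a unitary-valued field within `s₀` of `1` with the budget at
level `k`, `30400·ℓ²·Lᵏ·s₀ ≤ 1`, every centre stair of every `U̿^{(i)}`, `i < k`, is unitary.
[cite: Balaban1985Averaging, (110) p.34, Prop. 4 (134)-(135) p.38] -/
theorem hWu_of_mem_unitaryGroup {k : ℕ} (hk : k ≤ P.m + P.K) (U : GaugeField P 0 (Matrix (Fin 2) (Fin 2) ℂ)ˣ) {s₀ : ℝ} (hs₀ : 0 ≤ s₀)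
    (hbudget : 8 * 3800 * (((P.d + 2) * P.L : ℕ) : ℝ) ^ 2 * (P.L : ℝ) ^ k * s₀ ≤ 1)
    (hU : ∀ b : PBond P 0, ‖((U b : (Matrix (Fin 2) (Fin 2) ℂ)ˣ) : Matrix (Fin 2) (Fin 2) ℂ) - 1‖ ≤ s₀)
    (hun : ∀ b : PBond P 0, ((U b : (Matrix (Fin 2) (Fin 2) ℂ)ˣ) : Matrix (Fin 2) (Fin 2) ℂ) ∈ Matrix.unitaryGroup (Fin 2) ℂ) :
    ∀ i < k, ∀ (y : Site P (i + 1)) (idx : Idx P),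
      ((holT (dbarIterU i U) (emb y) (stairWord idx.2.1 (off idx.1)) : (Matrix (Fin 2) (Fin 2) ℂ)ˣ) : Matrix (Fin 2) (Fin 2) ℂ) ∈
        unitary (Matrix (Fin 2) (Fin 2) ℂ) := by
  intro i hi y idx
  have hL1 : (1 : ℝ) ≤ P.L := by exact_mod_cast P.L_pos
  have hbudget_i : 8 * 3800 * (((P.d + 2) * P.L : ℕ) : ℝ) ^ 2 * (P.L : ℝ) ^ i * s₀ ≤ 1 := by
    refine le_trans ?_ hbudget
    have hpow : (P.L : ℝ) ^ i ≤ (P.L : ℝ) ^ k := pow_le_pow_right₀ hL1 hi.le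
    have h0 : 0 ≤ 8 * 3800 * (((P.d + 2) * P.L : ℕ) : ℝ) ^ 2 * s₀ := by positivity
    nlinarith
  exact holT_dbarIterU_mem_unitaryGroup (le_trans (by omega) hk) U hs₀ hbudget_i hU hun (emb y) _

end Unitary

/-! ## §2 The size of `log κ_j` under ✓F2b's hypotheses -/

section Size

open LatticeFieldCalculus (siteAvgIter)

variable {𝔸 : Type*} [NormedRing 𝔸] [NormedAlgebra ℂ 𝔸] [CompleteSpace 𝔸]

/-- **★★ THE SIZE OF THE EFFECTIVE GAUGES IN LOG COORDINATES, EVERY LEVEL**: under EXACTLY the hypotheses of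
✓`P1FlatCoreFrameLinTowerSum.exp_mlog_and_norm_mlog_effGauge_sub_siteAvgIter_le` (tower `(W, κ)` started at `κ₀ = e^{l₀}`, `‖l₀‖ ≤ a`, stairs `δ`, top-anchored
oscillation `ω`, `160(a + δ + 5ω) ≤ 1∕4`), at every level `j ≤ k` and every site: `κ_j = e^{log κ_j}` and `‖log κ_j‖ ≤ a + ω` — the `a″` of ★w3-19936 g6's window
suppliers `norm_stairRel_sub_one_le_twelfth`∕`norm_exp_sub_one_le_twelfth` (with `l := log ∘ κ_j`). [cite: Balaban1985RegularSpaces, Sect. E (1.120)-(1.121) pp.95-96] -/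
theorem exp_mlog_and_norm_mlog_effGauge_le [Nonempty (Idx P)] (W : GaugeField P 0 𝔸ˣ) (κ : (i : ℕ) → GaugeTransf P i 𝔸ˣ)
    (hs : ∀ (i : ℕ) (y : Site P (i + 1)),
      κ (i + 1) y = (vframeU (gaugeActT (κ i) (dbarIterU i W)) y)⁻¹ * κ i (emb y) * vframeU (dbarIterU i W) y)
    (l₀ : Site P 0 → 𝔸) (hκ0 : ∀ x, ((κ 0 x : 𝔸ˣ) : 𝔸) = exp (l₀ x)) {a δ ω : ℝ} (hδ : 0 ≤ δ) (hω : 0 ≤ ω)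
    (ha : ∀ x, ‖l₀ x‖ ≤ a) (k : ℕ)
    (hH : ∀ j < k, ∀ (y : Site P (j + 1)) (idx : Idx P),
      ‖((holT (dbarIterU j W) (emb y) (stairWord idx.2.1 (off idx.1)) : 𝔸ˣ) : 𝔸) - 1‖ ≤ δ)
    (hosc : ∀ j < k, ∀ (y : Site P (j + 1)) (idx : Idx P),
      ‖siteAvgIter j l₀ (walkEnd (emb y) (stairWord idx.2.1 (off idx.1))) - siteAvgIter j l₀ (emb y)‖ ≤ ω * 2 ^ (j + 1) / 2 ^ k)
    (hr : 160 * (a + δ + 5 * ω) ≤ 1 / 4) :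
    ∀ j ≤ k, ∀ x : Site P j, exp (mlog ((κ j x : 𝔸ˣ) : 𝔸)) = ((κ j x : 𝔸ˣ) : 𝔸) ∧ ‖mlog ((κ j x : 𝔸ˣ) : 𝔸)‖ ≤ a + ω := by
  have hF := exp_mlog_and_norm_mlog_effGauge_sub_siteAvgIter_le W κ hs l₀ hκ0 hδ hω ha k hH hosc hr
  have ha0 : 0 ≤ a := (norm_nonneg _).trans (ha (emb (Classical.arbitrary (Site P 1))))
  have h2k : (0 : ℝ) < 2 ^ k := by positivity
  intro j hj x
  obtain ⟨he, hd⟩ := hF j hj x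
  refine ⟨he, ?_⟩
  have hL := norm_siteAvgIter_le l₀ ha0 ha j x
  have hq : (2 : ℝ) ^ j / 2 ^ k ≤ 1 := by
    rw [div_le_one h2k]
    exact pow_le_pow_right₀ (by norm_num) hj
  have hεω : 4 * (160 * (a + δ + 5 * ω)) * ω * (2 ^ j / 2 ^ k) ≤ ω := by
    have h1 : 4 * (160 * (a + δ + 5 * ω)) ≤ 1 := by linarith
    have h0 : 0 ≤ 4 * (160 * (a + δ + 5 * ω)) * ω := by positivity
    calc 4 * (160 * (a + δ + 5 * ω)) * ω * (2 ^ j / 2 ^ k) ≤ 4 * (160 * (a + δ + 5 * ω)) * ω * 1 :=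
          mul_le_mul_of_nonneg_left hq h0
      _ ≤ 1 * ω * 1 := by gcongr
      _ = ω := by ring
  calc ‖mlog ((κ j x : 𝔸ˣ) : 𝔸)‖ = ‖(mlog ((κ j x : 𝔸ˣ) : 𝔸) - siteAvgIter j l₀ x) + siteAvgIter j l₀ x‖ := by rw [sub_add_cancel]
    _ ≤ ω + a := (norm_add_le _ _).trans (add_le_add (hd.trans hεω) hL)
    _ = a + ω := add_comm _ _

/-- **THE TWO WINDOWS OF ★w3-19936 g6's SUPPLIERS FOLLOW FROM ✓F2b's**: `160(a + δ + 5ω) ≤ 1∕4`, `0 ≤ δ`, `0 ≤ ω` ⇒ `2δ + 4(a + ω) ≤ 1∕24` and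
`a + ω ≤ 1∕24` (the `hr` of `norm_stairRel_sub_one_le_twelfth` and the `hl` of `norm_exp_sub_one_le_twelfth` at `a″ := a + ω`). [folklore] -/
theorem windows_of_towerSum {a δ ω : ℝ} (hδ : 0 ≤ δ) (hω : 0 ≤ ω) (hr : 160 * (a + δ + 5 * ω) ≤ 1 / 4) :
    2 * δ + 4 * (a + ω) ≤ 1 / 24 ∧ a + ω ≤ 1 / 24 := by
  constructor <;> linarith

end Size

/-! ## §3 The stair window of the tower of one globally small field (✓F2b's `hH`, ★w3's `hWs`) -/

section Stairs

variable {𝔸 : Type*} [NormedRing 𝔸] [NormedAlgebra ℂ 𝔸] [CompleteSpace 𝔸] [NormOneClass 𝔸]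

/-- **THE BLOCK-LOCAL STAIR WINDOW** (read territory = the `(i+1)`-block of `y`): if the bond variables of `U` whose `(i+1)`-fold block points are `y` are within
`s₀` of `1`, `30400·ℓ²·Lⁱ·s₀ ≤ 1`, then every centre stair of `U̿^{(i)}` in the block of `y` is within `8ℓ·Lⁱ·s₀` of `1` (✓`norm_dbarIterU_sub_one_le_two_mul₀` with `S :=`
the level-`i` sites of the block, ✓`norm_holT_stair_sub_one_le`). [cite: Balaban1985Averaging, Prop. 4 (134)-(135) p.38, (110) p.34] -/
theorem norm_holT_stair_dbarIterU_sub_one_le_of_reads {i : ℕ} (hi : i + 1 ≤ P.m + P.K) (y : Site P (i + 1)) (U : GaugeField P 0 𝔸ˣ) {s₀ : ℝ} (hs₀ : 0 ≤ s₀)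
    (hbudget : 8 * 3800 * (((P.d + 2) * P.L : ℕ) : ℝ) ^ 2 * (P.L : ℝ) ^ i * s₀ ≤ 1)
    (hU : ∀ b : PBond P 0, iterBlockOf (i + 1) b.src = y → iterBlockOf (i + 1) b.tgt = y → ‖((U b : 𝔸ˣ) : 𝔸) - 1‖ ≤ s₀) (idx : Idx P) :
    ‖((holT (dbarIterU i U) (emb y) (stairWord idx.2.1 (off idx.1)) : 𝔸ˣ) : 𝔸) - 1‖ ≤ 8 * (((P.d + 2) * P.L : ℕ) : ℝ) * (P.L : ℝ) ^ i * s₀ := by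
  set ℓ : ℝ := (((P.d + 2) * P.L : ℕ) : ℝ) with hℓ
  have hℓ1 : (1 : ℝ) ≤ ℓ := by
    rw [hℓ]; exact_mod_cast Nat.one_le_iff_ne_zero.mpr (Nat.mul_ne_zero (by omega) (by have := P.hL.2; omega))
  have hx0 : 0 ≤ (P.L : ℝ) ^ i * s₀ := by positivity
  set S : Set (Site P i) := {z | blockOf z = y} with hS
  have hbond : ∀ e : PBond P i, e.src ∈ S → e.tgt ∈ S → ‖((dbarIterU i U e : 𝔸ˣ) : 𝔸) - 1‖ ≤ 2 * ((P.L : ℝ) ^ i * s₀) := fun e hs ht =>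
    norm_dbarIterU_sub_one_le_two_mul₀ (Nat.le_of_succ_le hi) S U hs₀ hbudget
      (fun b hs ht => hU b (by rw [iterBlockOf_succ]; exact hs) (by rw [iterBlockOf_succ]; exact ht)) e hs ht
  have h4 : 4 * ℓ * (2 * ((P.L : ℝ) ^ i * s₀)) ≤ 1 := by
    have h1 : ℓ * ((P.L : ℝ) ^ i * s₀) ≤ ℓ ^ 2 * ((P.L : ℝ) ^ i * s₀) := by
      have : ℓ ≤ ℓ ^ 2 := by nlinarith
      exact mul_le_mul_of_nonneg_right this hx0
    nlinarith
  have hst := (norm_holT_stair_sub_one_le hi y (by positivity : (0 : ℝ) ≤ 2 * ((P.L : ℝ) ^ i * s₀)) h4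
    (fun b hb1 hb2 => hbond b hb1 hb2) idx).1
  exact hst.trans (le_of_eq (by ring))

/-- **★★ THE STAIR WINDOW OF THE DOUBLE-BAR TOWER OF ONE GLOBALLY SMALL FIELD**: if every bond variable of `U` is within `s₀` of `1` and the budget holds at level `k`,
`30400·ℓ²·Lᵏ·s₀ ≤ 1` (`ℓ = (d+2)L`), then every centre stair of every `U̿^{(j)}`, `j < k`, is within `8ℓ·Lᵏ·s₀` of `1` — ✓F2b's `hH` binder and ★w3's `hWs`
with ONE `k`-uniform `δ := 8ℓLᵏs₀` (✓`norm_dbarIterU_sub_one_le_two_mul₀` on the whole torus: `‖U̿^{(j)}(e) − 1‖ ≤ 2Lʲs₀`; ✓`norm_holT_stair_sub_one_le`: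
stairs `≤ 4ℓ·(2Lʲs₀)`; `Lʲ ≤ Lᵏ`). [cite: Balaban1985Averaging, Prop. 4 (134)-(135) p.38, (110) p.34] -/
theorem norm_holT_stair_dbarIterU_sub_one_le {k : ℕ} (hk : k ≤ P.m + P.K) (U : GaugeField P 0 𝔸ˣ) {s₀ : ℝ} (hs₀ : 0 ≤ s₀)
    (hbudget : 8 * 3800 * (((P.d + 2) * P.L : ℕ) : ℝ) ^ 2 * (P.L : ℝ) ^ k * s₀ ≤ 1)
    (hU : ∀ b : PBond P 0, ‖((U b : 𝔸ˣ) : 𝔸) - 1‖ ≤ s₀) :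
    ∀ j < k, ∀ (y : Site P (j + 1)) (idx : Idx P),
      ‖((holT (dbarIterU j U) (emb y) (stairWord idx.2.1 (off idx.1)) : 𝔸ˣ) : 𝔸) - 1‖ ≤
        8 * (((P.d + 2) * P.L : ℕ) : ℝ) * (P.L : ℝ) ^ k * s₀ := by
  intro j hj y idx
  set ℓ : ℝ := (((P.d + 2) * P.L : ℕ) : ℝ) with hℓ
  have hℓ1 : (1 : ℝ) ≤ ℓ := by
    rw [hℓ]; exact_mod_cast Nat.one_le_iff_ne_zero.mpr (Nat.mul_ne_zero (by omega) (by have := P.hL.2; omega))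
  have hL1 : (1 : ℝ) ≤ P.L := by exact_mod_cast P.L_pos
  have hpow : (P.L : ℝ) ^ j ≤ (P.L : ℝ) ^ k := pow_le_pow_right₀ hL1 hj.le
  have hx0 : 0 ≤ (P.L : ℝ) ^ j * s₀ := by positivity
  have hbudget_j : 8 * 3800 * ℓ ^ 2 * (P.L : ℝ) ^ j * s₀ ≤ 1 := by
    refine le_trans ?_ hbudget
    have h0 : 0 ≤ 8 * 3800 * ℓ ^ 2 * s₀ := by positivity
    nlinarith
  -- the level-`j` bonds: `‖U̿^{(j)}(e) − 1‖ ≤ 2Lʲs₀` everywhere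
  have hbond : ∀ e : PBond P j, ‖((dbarIterU j U e : 𝔸ˣ) : 𝔸) - 1‖ ≤ 2 * ((P.L : ℝ) ^ j * s₀) := fun e =>
    norm_dbarIterU_sub_one_le_two_mul₀ (le_trans (by omega) hk) Set.univ U hs₀ hbudget_j (fun b _ _ => hU b) e (Set.mem_univ _) (Set.mem_univ _)
  -- the stairs: `≤ 4ℓ·(2Lʲs₀)` (window `4ℓ·(2Lʲs₀) ≤ 1` from the budget)
  have h4 : 4 * ℓ * (2 * ((P.L : ℝ) ^ j * s₀)) ≤ 1 := by
    have h1 : ℓ * ((P.L : ℝ) ^ j * s₀) ≤ ℓ ^ 2 * ((P.L : ℝ) ^ j * s₀) := by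
      have : ℓ ≤ ℓ ^ 2 := by nlinarith
      exact mul_le_mul_of_nonneg_right this hx0
    nlinarith
  have hst := (norm_holT_stair_sub_one_le (le_trans (by omega) hk) y (by positivity : (0 : ℝ) ≤ 2 * ((P.L : ℝ) ^ j * s₀)) h4
    (fun b _ _ => hbond b) idx).1
  refine hst.trans ?_
  have h0 : 0 ≤ 8 * ℓ * s₀ := by positivity
  calc 4 * ℓ * (2 * ((P.L : ℝ) ^ j * s₀)) = 8 * ℓ * s₀ * (P.L : ℝ) ^ j := by ring
    _ ≤ 8 * ℓ * s₀ * (P.L : ℝ) ^ k := mul_le_mul_of_nonneg_left hpow h0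
    _ = 8 * ℓ * (P.L : ℝ) ^ k * s₀ := by ring

end Stairs

/-! ## §4 (v1.1) The size of `log κ_j` under ✓F2-local's hypotheses (tower-local `S`-family) -/

section SizeLocal

open LatticeFieldCalculus (siteAvgIter)
open Summit.QuantumFields.YangMills.Theorems.P1FlatCoreFrameLinLocal (exp_mlog_and_norm_mlog_effGauge_sub_siteAvgIter_le_local
  norm_siteAvgIter_le_local)

variable {𝔸 : Type*} [NormedRing 𝔸] [NormedAlgebra ℂ 𝔸] [CompleteSpace 𝔸]

/-- **★★ THE SIZE OF THE EFFECTIVE GAUGES IN LOG COORDINATES, TOWER-LOCAL**: under EXACTLY the hypotheses of ★w3-19936 g6's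
✓`P1FlatCoreFrameLinLocal.exp_mlog_and_norm_mlog_effGauge_sub_siteAvgIter_le_local` (site family `S` closed under block centres `hSe` and stair ends `hSs`;
`‖l₀‖ ≤ a` on `S 0`, stairs `δ` and top-anchored linear oscillation `ω` on `S`; `160(a + δ + 5ω) ≤ 1∕4`), at every level `j ≤ k` and every `y ∈ S j`:
`κ_j(y) = e^{log κ_j(y)}` and `‖log κ_j(y)‖ ≤ a + ω` — the `a″ := a + ω` of ✓`…FrameLinReal`'s twelfth-window suppliers, for the `_local` rows of (T4b).
[cite: Balaban1985RegularSpaces, Sect. E (1.120)-(1.121) pp.95-96] -/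
theorem exp_mlog_and_norm_mlog_effGauge_le_local [Nonempty (Idx P)] (W : GaugeField P 0 𝔸ˣ) (κ : (i : ℕ) → GaugeTransf P i 𝔸ˣ)
    (hs : ∀ (i : ℕ) (y : Site P (i + 1)),
      κ (i + 1) y = (vframeU (gaugeActT (κ i) (dbarIterU i W)) y)⁻¹ * κ i (emb y) * vframeU (dbarIterU i W) y)
    (l₀ : Site P 0 → 𝔸) (hκ0 : ∀ x, ((κ 0 x : 𝔸ˣ) : 𝔸) = exp (l₀ x)) {a δ ω : ℝ} (ha0 : 0 ≤ a) (hδ : 0 ≤ δ) (hω : 0 ≤ ω)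
    (k : ℕ) (S : (j : ℕ) → Set (Site P j))
    (hSe : ∀ j < k, ∀ y ∈ S (j + 1), emb y ∈ S j)
    (hSs : ∀ j < k, ∀ y ∈ S (j + 1), ∀ idx : Idx P, walkEnd (emb y) (stairWord idx.2.1 (off idx.1)) ∈ S j)
    (ha : ∀ x ∈ S 0, ‖l₀ x‖ ≤ a)
    (hH : ∀ j < k, ∀ y ∈ S (j + 1), ∀ idx : Idx P,
      ‖((holT (dbarIterU j W) (emb y) (stairWord idx.2.1 (off idx.1)) : 𝔸ˣ) : 𝔸) - 1‖ ≤ δ)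
    (hosc : ∀ j < k, ∀ y ∈ S (j + 1), ∀ idx : Idx P,
      ‖siteAvgIter j l₀ (walkEnd (emb y) (stairWord idx.2.1 (off idx.1))) - siteAvgIter j l₀ (emb y)‖ ≤ ω * 2 ^ (j + 1) / 2 ^ k)
    (hr : 160 * (a + δ + 5 * ω) ≤ 1 / 4) :
    ∀ j ≤ k, ∀ y ∈ S j, exp (mlog ((κ j y : 𝔸ˣ) : 𝔸)) = ((κ j y : 𝔸ˣ) : 𝔸) ∧ ‖mlog ((κ j y : 𝔸ˣ) : 𝔸)‖ ≤ a + ω := by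
  have hF := exp_mlog_and_norm_mlog_effGauge_sub_siteAvgIter_le_local W κ hs l₀ hκ0 ha0 hδ hω k S hSe hSs ha hH hosc hr
  have hL := norm_siteAvgIter_le_local l₀ ha0 k S hSs ha
  have h2k : (0 : ℝ) < 2 ^ k := by positivity
  intro j hj y hy
  obtain ⟨he, hd⟩ := hF j hj y hy
  refine ⟨he, ?_⟩
  have hq : (2 : ℝ) ^ j / 2 ^ k ≤ 1 := by
    rw [div_le_one h2k]
    exact pow_le_pow_right₀ (by norm_num) hj
  have hεω : 4 * (160 * (a + δ + 5 * ω)) * ω * (2 ^ j / 2 ^ k) ≤ ω := by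
    have h1 : 4 * (160 * (a + δ + 5 * ω)) ≤ 1 := by linarith
    have h0 : 0 ≤ 4 * (160 * (a + δ + 5 * ω)) * ω := by positivity
    calc 4 * (160 * (a + δ + 5 * ω)) * ω * (2 ^ j / 2 ^ k) ≤ 4 * (160 * (a + δ + 5 * ω)) * ω * 1 :=
          mul_le_mul_of_nonneg_left hq h0
      _ ≤ 1 * ω * 1 := by gcongr
      _ = ω := by ring
  calc ‖mlog ((κ j y : 𝔸ˣ) : 𝔸)‖ = ‖(mlog ((κ j y : 𝔸ˣ) : 𝔸) - siteAvgIter j l₀ y) + siteAvgIter j l₀ y‖ := by rw [sub_add_cancel]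
    _ ≤ ω + a := (norm_add_le _ _).trans (add_le_add (hd.trans hεω) (hL j hj y hy))
    _ = a + ω := add_comm _ _

end SizeLocal

end Summit.QuantumFields.YangMills.Theorems.P1FlatCoreFrameLinStar

end
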